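import Literature.MathematicalPhysics.QuantumLattice.FermiRG.BGM2006Sec3Flow
import Literature.MathematicalPhysics.QuantumLattice.FermiRG.BGM2006AppA
import Literature.MathematicalPhysics.QuantumLattice.FermiRG.BGM2006Sec2Expansion
import HarnessLib

/-!
# BGM 2006 §3 / App. A1 — proved consequences of the typed statements ((3.70), the induction skeleton, (A1.1))

Companion of `BGM2006Sec3Flow.lean` and `BGM2006AppA.lean` (Benfatto–Giuliani–Mastropietro, Ann. Henri
Poincaré **7** (2006) 809 = arXiv:cond-mat/0507686 [cite: BenfattoGiulianiMastropietro2006, §3, App. A1];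
typer wave gate-hubbard-kl, seat t2). Those files type the statements as predicates on scale-indexed data
(statement-only lane); this file PROVES the elementary implications the source states in prose, which also
certify that the typed quantifier structure composes the way the induction of §3 requires:

* `abs_mul_abs_le_of_smallC0` — the `c₀` device gives `|j||U| ≤ c₀` on every scale `h_β ≤ j ≤ 0` ((3.70), (3.76));
* `hyp236_of_bound32` — "(2.36) easily follows from Theorem (3.1)" via (3.3) (p0019:L82);
* `hyp236_downward` — Theorem 3.1 + (3.65) at every scale ⟹ (2.36) at every scale (downward induction);
* `bound365_of_flow` — (3.66) + "|β⁴| ≤ c|U|²" (conditional) + `|j||U| ≤ c₀` ⟹ (3.70): (2.71a) at every scale —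
  the tree's `RunningCouplingFlow.abs_le_of_conditional_increments` in this vocabulary;
* `hyp236_and_bound365_all` — Theorem 3.1 and the §3.2 claim at COMMON constants give (2.36) and (2.71a) at
  every scale `h_β ≤ h ≤ 0` ("Combining this result with the results discussed above in Sect. 3.1 finally
  completes the inductive proof of the validity of (2.36) and of (2.71a)", p0033:L74);
* `scalingDim_le_of_six_le` — `δ(p) ≤ −½` for `p ≥ 6` (Remark after (2.78));
* `sum_uvSlice` — the ultraviolet slices (A1.2) telescope: `Σ_{n=0}^{N} h_n(k₀) = H₀(γ^{−N}|k₀|)`, whence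
  `g^{[1,N]} → g^{(+1)}` (A1.1) (this is the identity that fixes the orientation of the difference in (A1.2));
* DEDUP BRIDGES to the §2 files of the same wave (t1, `BGM2006Sec2Setup` / `BGM2006Sec2Expansion`, landed
  while the t2 files were being written) and to the tree: `scalingDim_eq_bgmDelta` ((2.78): the two copies
  are definitionally equal), `scaleIdx_eq_bgmScaleIdx`, `sSector_four_eq_bgmSSector` (my s-sector family at
  `γ = 4` and `eps h = ε_h = bgmEffDisp β E h` IS t1's `bgmSSector … (bgmScaleIdx h)`),
  `sSector_four_const_eq` (at a fixed dispersion it is the tree's `sSector` of `SSectorNesting`),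
  `bgmSectorCompatible_iff_chi` ((2.73): t1's `BGMSectorCompatible` at `|P_v| < 10` IS `chi` on anisotropic labels).

Everything is proved; no definitions, no named facts.
-/

noncomputable section

open Finset

namespace Literature.MathematicalPhysics.QuantumLattice.FermiRG

namespace BGM2006Sec3

/-- Under the `c₀` device every scale `h_β ≤ j ≤ 0` has `|j|·|U| ≤ c₀` — "where in the last passage we used
that `|j||U| ≤ c₀`" ((3.70) p0034:L29; likewise (3.76) "`|U||k| ≤ c₀`"). [cite: BenfattoGiulianiMastropietro2006, §3.2 (3.70) p0034:L29] -/
theorem abs_mul_abs_le_of_smallC0 {D : ScaleData} {c₀ : ℝ} (hc : SmallC0 D c₀) {j : ℤ} (hj : D.hβ ≤ j)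
    (hj0 : j ≤ 0) : |(j : ℝ)| * |D.U| ≤ c₀ := by
  obtain ⟨hU, hβ⟩ := hc
  have h1 : |(j : ℝ)| ≤ |(D.hβ : ℝ)| := by
    rw [abs_of_nonpos (by exact_mod_cast hj0), abs_of_nonpos (by exact_mod_cast (hj.trans hj0))]
    exact neg_le_neg (by exact_mod_cast hj)
  have hU0 : 0 ≤ D.U₀ := (abs_nonneg _).trans hU
  calc |(j : ℝ)| * |D.U| ≤ |(D.hβ : ℝ)| * D.U₀ := mul_le_mul h1 hU (abs_nonneg _) (abs_nonneg _)
    _ = D.U₀ * |(D.hβ : ℝ)| := mul_comm _ _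
    _ ≤ c₀ := hβ

/-- "Note that the bound (2.36) easily follows from Theorem (3.1)" (p0019:L82): (3.3) turns (3.2) at scale
`h` into (2.36) at scale `h`, with the same constants. [cite: BenfattoGiulianiMastropietro2006, §3.1 (3.3) p0019:L82] -/
theorem hyp236_of_bound32 {D : ScaleData} {C : ℕ → ℝ} {h : ℤ} (hL : Link33 D) (h32 : Bound32 D C h) :
    Hyp236 D C h :=
  ⟨(hL h 0).trans h32.1, fun n hn => (hL h n).trans (h32.2 n hn)⟩

/-- **The induction of §3.1 in skeleton form**: if Theorem 3.1 holds (at the constants `C, Cl, c₀`), the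
`c₀` device is in force, (3.3) links the norms, and the smallness (2.71a) = (3.65) holds at every scale
`h_β ≤ j ≤ 0` (the output of §3.2), then (2.36) holds at every scale `h_β ≤ h ≤ 0` — by downward induction
from `h = 0` (where the dispersion hypothesis is empty). [cite: BenfattoGiulianiMastropietro2006, §3.1 p0019:L49-52] -/
theorem hyp236_downward {D : ScaleData} {C : ℕ → ℝ} {Cl c₀ : ℝ} (hT : Theorem31 D C Cl c₀)
    (hc : SmallC0 D c₀) (hL : Link33 D) (hlam : ∀ j : ℤ, D.hβ ≤ j → j ≤ 0 → Bound365 D Cl j) :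
    ∀ h : ℤ, D.hβ ≤ h → h ≤ 0 → Hyp236 D C h := by
  -- strong induction on `m = −h`
  suffices H : ∀ m : ℕ, ∀ h : ℤ, h = -(m : ℤ) → D.hβ ≤ h → Hyp236 D C h by
    intro h hβh hh0
    exact H (-h).toNat h (by rw [Int.toNat_of_nonneg (by omega)]; ring) hβh
  intro m
  induction m using Nat.strong_induction_on with
  | _ m ih =>
    intro h hm hβh
    have hh0 : h ≤ 0 := by omega
    refine hyp236_of_bound32 hL (hT hc h hβh hh0 ?_ fun j hj hj0 => hlam j (hβh.trans hj) hj0)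
    intro j hj hj0
    exact ih (-j).toNat (by omega) j (by rw [Int.toNat_of_nonneg (by omega)]; ring) (by omega)

/-- `δ(p) ≤ −1/2` for `6 ≤ p ≤ 8` and `δ(4) = 0`: "clusters with `|P_v| = 2` are not allowed, and clusters with
`|P_v| = 4` are necessarily endpoints. Then the exponent `δ(|P_v|)` … is always `≤ −1/2`" (Remark after (2.78),
p0015:L75) — for the even leg numbers `6 ≤ p` that occur. [cite: BenfattoGiulianiMastropietro2006, §2.8 (2.78) p0015:L75] -/
theorem scalingDim_le_of_six_le {p : ℕ} (hp : 6 ≤ p) : scalingDim p ≤ -1 / 2 := by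
  unfold scalingDim
  have hp' : (6 : ℝ) ≤ p := by exact_mod_cast hp
  split_ifs with h10
  · have : (10 : ℝ) ≤ p := by exact_mod_cast h10
    linarith
  · linarith

/-- **(3.70)** (p0034:L28: `|λ̃_{j,Ω₄}(x)| ≤ C₀|U| + c|j||U|² ≤ C|U|`, "where in the last passage we used that
`|j||U| ≤ c₀`. This completes the proof of (2.71a)") — PROVED at the norm level: from the split (3.66), the
bound `C₀|U|` on the `λ₀` term, the conditional increment bound `c|U|²`, the device `|j||U| ≤ c₀` on
`h_β ≤ j ≤ 0` and `C₀ + c·c₀ ≤ C`, the smallness (3.65) holds at EVERY scale `h_β ≤ j ≤ 0`, by downward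
induction from `j = 0`. This is `abs_le_of_conditional_increments` / `runningCoupling_abs_le` of the tree's
`RunningCouplingFlow` in the vocabulary of this file. [cite: BenfattoGiulianiMastropietro2006, §3.2 (3.70) p0034:L28] -/
theorem bound365_of_flow {D : ScaleData} {C₀ c Cl c₀ : ℝ} (hsplit : FlowSplit366 D) (h0 : Lam0Bound D C₀)
    (hβ : BetaFnBound D Cl c) (hc : 0 ≤ c) (hdev : SmallC0 D c₀) (hC : C₀ + c * c₀ ≤ Cl) :
    ∀ j : ℤ, D.hβ ≤ j → j ≤ 0 → Bound365 D Cl j := by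
  suffices H : ∀ m : ℕ, ∀ j : ℤ, j = -(m : ℤ) → D.hβ ≤ j → Bound365 D Cl j by
    intro j hβj hj0
    exact H (-j).toNat j (by rw [Int.toNat_of_nonneg (by omega)]; ring) hβj
  intro m
  induction m using Nat.strong_induction_on with
  | _ m ih =>
    intro j hm hβj
    have hj0 : j ≤ 0 := by omega
    -- every increment above `j` is bounded by `c|U|²`, by the induction hypothesis
    have hincr : ∀ j' ∈ Finset.Ioc j 0, D.betaFnL1 j j' ≤ c * |D.U| ^ 2 := by
      intro j' hj'
      rw [Finset.mem_Ioc] at hj'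
      refine hβ j j' hβj hj'.1 hj'.2 fun j'' h1 h2 => ?_
      exact ih (-j'').toNat (by omega) j'' (by rw [Int.toNat_of_nonneg (by omega)]; ring) (by omega)
    have hcard : ((Finset.Ioc j 0).card : ℝ) = |(j : ℝ)| := by
      rw [Int.card_Ioc]
      have h1 : (((0 - j).toNat : ℕ) : ℤ) = -j := by rw [Int.toNat_of_nonneg (by omega)]; ring
      have h2 : (((0 - j).toNat : ℕ) : ℝ) = ((-j : ℤ) : ℝ) := by exact_mod_cast h1
      rw [h2, abs_of_nonpos (by exact_mod_cast hj0)]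
      push_cast; ring
    have hjU : |(j : ℝ)| * |D.U| ≤ c₀ := abs_mul_abs_le_of_smallC0 hdev hβj hj0
    unfold Bound365
    calc D.lamL1 j ≤ D.lam0L1 j + ∑ j' ∈ Finset.Ioc j 0, D.betaFnL1 j j' := hsplit j hβj hj0
      _ ≤ C₀ * |D.U| + ∑ _j' ∈ Finset.Ioc j 0, c * |D.U| ^ 2 := add_le_add (h0 j hβj hj0) (sum_le_sum hincr)
      _ = C₀ * |D.U| + c * (|(j : ℝ)| * |D.U|) * |D.U| := by
          rw [sum_const, nsmul_eq_mul, hcard]; ring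
      _ ≤ C₀ * |D.U| + c * c₀ * |D.U| := by
          have : c * (|(j : ℝ)| * |D.U|) ≤ c * c₀ := mul_le_mul_of_nonneg_left hjU hc
          nlinarith [abs_nonneg D.U]
      _ = (C₀ + c * c₀) * |D.U| := by ring
      _ ≤ Cl * |D.U| := mul_le_mul_of_nonneg_right hC (abs_nonneg _)

/-- **The two halves assembled** (p0033:L74–76: "Combining this result with the results discussed above in
Sect. 3.1 finally completes the inductive proof of the validity of (2.36) and of (2.71a)"): Theorem 3.1 and
the §3.2 claim at common constants, the `c₀` device and the link (3.3) give (2.36) AND (2.71a) at every scale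
`h_β ≤ h ≤ 0`. PROVED (downward induction; at `h = 0` both scale hypotheses are empty or immediate).
[cite: BenfattoGiulianiMastropietro2006, §3.2 p0033:L74] -/
theorem hyp236_and_bound365_all {D : ScaleData} {C : ℕ → ℝ} {Cl c₀ : ℝ} {c38 : ℕ → ℝ}
    (hT : Theorem31 D C Cl c₀) (hS : Sec32Claim D C Cl c38 c₀) (hc : SmallC0 D c₀) (hL : Link33 D) :
    ∀ h : ℤ, D.hβ ≤ h → h ≤ 0 → Hyp236 D C h ∧ Bound365 D Cl h := by
  suffices H : ∀ m : ℕ, ∀ h : ℤ, h = -(m : ℤ) → D.hβ ≤ h → Hyp236 D C h ∧ Bound365 D Cl h by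
    intro h hβh hh0
    exact H (-h).toNat h (by rw [Int.toNat_of_nonneg (by omega)]; ring) hβh
  intro m
  induction m using Nat.strong_induction_on with
  | _ m ih =>
    intro h hm hβh
    have hh0 : h ≤ 0 := by omega
    have habove : ∀ j : ℤ, h < j → j ≤ 0 → Hyp236 D C j := fun j hj hj0 =>
      (ih (-j).toNat (by omega) j (by rw [Int.toNat_of_nonneg (by omega)]; ring) (by omega)).1
    have hlam : ∀ j : ℤ, h ≤ j → j ≤ 0 → Bound365 D Cl j := fun j hj hj0 =>
      ((hS hc h hβh hh0 habove).1 j hj hj0).1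
    exact ⟨hyp236_of_bound32 hL (hT hc h hβh hh0 habove hlam), hlam h le_rfl hh0⟩

end BGM2006Sec3

namespace BGM2006AppA

/-- **(A1.1) at the level of cutoffs**: the slices `h_n` of (A1.2) telescope, `Σ_{n=0}^{N} h_n(k₀) = H₀(γ^{−N}|k₀|)`
(`= gnScaleCutoff γ e₀ N |k₀|`), which increases to `H₀(0) = 1` as `N → ∞` — "`lim_{N→∞} g^{[1,N]}(x) = g^{(+1)}(x)`"
(p0035:L15). [cite: BenfattoGiulianiMastropietro2006, App. A1 (A1.1) p0035:L8] -/
theorem sum_uvSlice (γ e₀ k₀ : ℝ) (N : ℕ) :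
    ∑ n ∈ Finset.range (N + 1), uvSlice γ e₀ n k₀ = gnScaleCutoff γ e₀ (N : ℤ) |k₀| := by
  induction N with
  | zero => simp [uvSlice, gnScaleCutoff]
  | succ N ih =>
    rw [sum_range_succ, ih]
    have h1 : uvSlice γ e₀ (N + 1) k₀ =
        gnScaleCutoff γ e₀ ((N : ℤ) + 1) |k₀| - gnScaleCutoff γ e₀ (N : ℤ) |k₀| := by
      simp only [uvSlice, Nat.succ_ne_zero, if_false, gnShell]
      push_cast
      simp
    rw [h1]; push_cast; ring

/-! ### Dedup bridges: (2.78), the scale index and the s-sectors agree with t1's §2 files and the tree -/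

/-- `δ(p)` of (2.78): the §3 copy `BGM2006Sec3.scalingDim` and t1's `bgmDelta` are the same function
(definitionally). [cite: BenfattoGiulianiMastropietro2006, §2.8 (2.78) p0015:L73] -/
theorem scalingDim_eq_bgmDelta (p : ℕ) : BGM2006Sec3.scalingDim p = bgmDelta p := rfl

/-- The scale index `n = −h` of §2.5 ("recall that `γ = 4`", `O_h` indexed by `γ^{−(h−1)/2} = 2^{n+1}`):
`BGM2006AppA.scaleIdx = bgmScaleIdx` (t1's copy), definitionally. [cite: BenfattoGiulianiMastropietro2006, §2.5 (2.45) p0010:L28] -/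
theorem scaleIdx_eq_bgmScaleIdx (h : ℤ) : scaleIdx h = bgmScaleIdx h := rfl

/-- **The s-sector families agree** ((2.69)): at `γ = 4` and `eps h = ε_h = bgmEffDisp β E h` (the effective
dispersion (2.36c) of t1's `BGM2006Sec2Setup`), `BGM2006AppA.sSector` is t1's `bgmSSector` with the anisotropic
angular index `m = n`. [cite: BenfattoGiulianiMastropietro2006, §2.7 (2.69) p0014:L66] -/
theorem sSector_four_eq_bgmSSector (β e₀ μ : ℝ) (E : ℤ → ℝ × (Fin 2 → ℝ) → ℂ) (h : ℤ) (ω : ℕ) :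
    sSector 4 e₀ μ (fun j k => bgmEffDisp β E j k) h ω = bgmSSector β e₀ μ E h (bgmScaleIdx h) (ω : ℤ) := by
  ext k
  simp only [sSector, bgmSSector, Set.mem_setOf_eq, scaleIdx, bgmScaleIdx]

/-- … and the isotropic family is `bgmSSector` with the angular index `m = 2n`. [cite: BenfattoGiulianiMastropietro2006, §2.5 (2.57) p0011:L110] -/
theorem sSectorIso_four_eq_bgmSSector (β e₀ μ : ℝ) (E : ℤ → ℝ × (Fin 2 → ℝ) → ℂ) (h : ℤ) (ω : ℕ) :
    sSectorIso 4 e₀ μ (fun j k => bgmEffDisp β E j k) h ω = bgmSSector β e₀ μ E h (2 * bgmScaleIdx h) (ω : ℤ) := by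
  ext k
  simp only [sSectorIso, bgmSSector, Set.mem_setOf_eq, scaleIdx, bgmScaleIdx]

/-- **At a fixed dispersion** `ε_h ≡ ε = sqDispersion` (no renormalisation of the Fermi surface) the family
`BGM2006AppA.sSector 4 e₀ μ (fun _ ↦ ε) (−n)` is the tree's `sSector e₀ μ n` of `SSectorNesting` (whose nesting
lemmas `sSector_child_subset`, `sSector_subset_of_le` therefore apply). [cite: BenfattoGiulianiMastropietro2006, §2.7 (2.69) p0014:L66] -/
theorem sSector_four_const_eq (e₀ μ : ℝ) (n : ℕ) (ω : ℕ) :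
    sSector 4 e₀ μ (fun _ k => sqDispersion k) (-(n : ℤ)) ω =
      Literature.MathematicalPhysics.QuantumLattice.sSector e₀ μ n (ω : ℤ) := by
  ext k
  simp only [sSector, Literature.MathematicalPhysics.QuantumLattice.sSector, Set.mem_setOf_eq, scaleIdx,
    neg_neg, Int.toNat_natCast, mul_comm ((4 : ℝ) ^ (-(n : ℤ))) e₀]

/-- **The constraint functions agree** ((2.73) p0015:L17–23 vs (2.84a)/(3.16)): for a vertex with
`q < 10` external fields, all sector labels ANISOTROPIC with scales `hf`, indices `ω` and charges `s`
(`true` = `+`), t1's `BGMSectorCompatible β e₀ μ E sgn hf ω` (F1b, `sgn f = ±1` the charge as an integer)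
IS this file's `chi` at `γ = 4`, `eps = ε_h = bgmEffDisp β E` on the corresponding `SectorLabel`s — the
s-sectors coincide by `sSector_four_eq_bgmSSector` and `(±1 : ℝ) • k = ±k`. (For `q ≥ 10` (2.73) sets
`χ := 1`, a convention `chi` deliberately does not carry; see its docstring.) Dedup bridge for consumers
binding t1's §2 vocabulary to the App. A counting statements (`LemmaA31`).
[cite: BenfattoGiulianiMastropietro2006, §2.8 (2.73) p0015:L17] -/
theorem bgmSectorCompatible_iff_chi (β e₀ μ : ℝ) (E : ℤ → ℝ × (Fin 2 → ℝ) → ℂ) {q : ℕ} (hq : q < 10)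
    (hf : Fin q → ℤ) (ω : Fin q → ℕ) (s : Fin q → Bool) :
    BGMSectorCompatible β e₀ μ E (fun f => if s f then (1 : ℤ) else -1) hf ω ↔
      chi 4 e₀ μ (fun j k => bgmEffDisp β E j k)
        (fun f => (⟨hf f, false, ω f, s f⟩ : SectorLabel)) := by
  have hq' : ¬ 10 ≤ q := Nat.not_le.mpr hq
  simp only [BGMSectorCompatible, hq', false_or, chi, SectorLabel.toSet, Bool.false_eq_true, if_false,
    sSector_four_eq_bgmSSector]
  constructor
  · rintro ⟨k, hk, hsum⟩
    refine ⟨k, fun i => hk i, ?_⟩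
    rw [← hsum]
    refine Finset.sum_congr rfl fun i _ => ?_
    by_cases hs : s i <;> simp [hs]
  · rintro ⟨k, hk, hsum⟩
    refine ⟨k, fun f => hk f, ?_⟩
    rw [← hsum]
    refine Finset.sum_congr rfl fun i _ => ?_
    by_cases hs : s i <;> simp [hs]

end BGM2006AppA

end Literature.MathematicalPhysics.QuantumLattice.FermiRG
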